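import Summits.BirchSwinnertonDyer.BirchSwinnertonDyer.Theorems.SignedLowerHalvesKobayashiLowerHalfSemistableScope
import Summits.BirchSwinnertonDyer.Rank1Residual.Supersingular.KobayashiMainConjectureX6BSTWScopeThree
import Summits.BirchSwinnertonDyer.Rank1Residual.SecondDescent.CanaryTargetsClassCertificates
import Literature.NumberTheory.QuadraticFields.ThreeIndivisibleClassNumberLocalConditions
import Literature.NumberTheory.EllipticCurves.SemistablePeuRamifieRamifiedPrime
import Literature.NumberTheory.EllipticCurves.Rank1Residual.X11Three
import Mathlib.Tactic.NormNum.LegendreSymbol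
import HarnessLib

/-!
# Route `SignedLowerHalves`, crux `KobayashiLowerHalfSemistable` (item stmt-BirchSwinnertonDyer-19000): the
# registered stub `stub_three` MODULO the `p = 3` TIER binder of the cell's reading of BSTW Thm 1.3, the crux BY
# NAME modulo the two tiers, and a kernel-checked scope witness at `p = 3` for the A6 cell `2534e1`
# (cell `bsd-ssimc`, seat `bsd-ssimc-k3-c2` gen 2, planner ORDERS v11 row k3-c2 (b); a `--supports … --as helper`
# file, closes nothing)

PARTITION (cell bsd-ssimc): X6 ∧ r = 0 (A6) × the 12 cells at `p = 3` (`a₃ = 0`; here 2534e1; the other eleven in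
the companion files `…ScopeThreeB/C/D.lean`) — types-the-object-of; closes NONE. THEOREMS ONLY. HONEST FRAMING:
nothing here is a theorem about Kobayashi's conjecture; every closure below is MODULO a named OPEN binder whose source
is the PREPRINT arXiv:2409.01350v2 resting, at `p = 3`, on the further preprint [SV-S-Ohta] (located residual
(3-ii)♭, REPORT-bstw-7 40fdbe7e627732c4); BSD is not proved by any of this; the crux stays OPEN on the ledger;
nothing is booked (RELAY-6: p = 3 rows are NOT bookable on cell verification).

## What this file adds to gen 0's `…SemistableScope.lean`

Gen 0 typed the cell-verified scope at `p ≥ 5` (`BurungaleSkinnerTianWan2024_thm13_scoped_OPEN`) and closed the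
registered stub `stub_five_le` modulo it and the class-wide L-witness `hwit`; the `p = 3` stub was reachable only
from the PRINTED binder. The companion definition file `Supersingular/KobayashiMainConjectureX6BSTWScopeThree.lean`
(this seat, gen 2) names the `p = 3` tier `BurungaleSkinnerTianWan2024_thm13_scopedAtThree_OPEN` (`p = 3`, `a₃ = 0`,
`Semistable`, `GoodSS`, `BSTWScope.HasWitness W 3` ⟹ MC both signs; docstring = what it rests on: the p ≥ 5 chain
+ M1–M3 + (3-ii)♭). Here:
* `stub_three_of_thm13_scopedAtThree_OPEN` — the registered stub `stub_three` (skeleton 7996fe656d66) VERBATIM, modulo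
  the p = 3 tier binder AND the class-wide witness at 3 (`hwit3`; NOT free class-wide, decidable per class);
* `KobayashiLowerHalfSemistable_of_thm13_scoped_OPEN_of_scopedAtThree_OPEN` — the crux BY NAME modulo exactly: the
  two tier binders (p ≥ 5: cell-verified PRE; p = 3: PRE on (3-ii)♭) and ONE class-wide witness hypothesis at every
  odd `p` — i.e. gen 0's `…_of_stub_three` with the `p = 3` stub itself discharged to its tier binder;
* **`BSTWScope_hasWitness_three_of_semistable` — the (α)-witness at `p = 3` is FREE CLASS-WIDE from PUBLISHED facts**:
  for every semistable `E` with good supersingular reduction at `3` there are a (ram) prime `q` (Ribet–Diamond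
  level-lowering, tree theorem `ram_of_semistable_of_irr_of_le_seven` modulo the named facts `exists_isNewformOf`
  (modularity) and `diamond1995_refinedSerre`) and an auxiliary imaginary quadratic `L` — `3` split, `q` inert, the
  other bad primes and `2` split, `3 ∤ h_L` — by the Davenport–Heilbronn theorem with local conditions
  (Bhargava–Varma, Proc. LMS 112 (2016) Cor. 4 (a): the average of `#Cl(L)[3]` over imaginary quadratic fields with
  any finite set of local conditions is `2`; named fact
  `bhargavaVarma2016_exists_imaginaryQuadratic_split_inert_three_not_dvd_classNumber`, this seat). Hence
  `stub_three_of_thm13_scopedAtThree_OPEN_of_published` — the registered stub modulo the p = 3 tier binder and THREE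
  PUBLISHED named facts, with NO per-class hypothesis — and `KobayashiLowerHalfSemistable_of_tiers_of_published` —
  the crux BY NAME modulo the two tier binders, the published facts, and the class-wide witness hypothesis AT `p ≥ 5`
  ONLY. The asymmetry is genuine and in print: at a prime `ℓ ≥ 5` no theorem gives `ℓ ∤ h_L` together with a
  splitting condition at `2`, `ℓ` split and an inert prime (Wiles, JLMS 92 (2015) Thm 0.0.1 and Beckwith 2017:
  split primes `≢ −1 (mod ℓ)`, odd primes only; Beckwith–Raum–Richter arXiv:2305.19272 Thm 1: split conditions only;
  Bruinier 1999: primes `≢ 0, ±1 (mod ℓ)` only), whereas at `ℓ = 3` Davenport–Heilbronn densities with arbitrary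
  local conditions are theorems;
* the scope witness at `p = 3` for `2534e1` (`q = 181`, `L = ℚ(√−47)`, `h = 5`) in the kernel (gen 0's F3
  pattern: bad primes confined by a factorisation certificate of `Δ`, the (ram) prime by Tate, Kronecker symbols by
  `norm_num`, `h(−D)` by `decide`), `ClassX6 W 3` by cc-eng-4's `classX6_three_of_intModel`, and the Eisenstein
  half for both signs modulo ONLY the p = 3 tier binder (the per-pair form a booking would consume).
All twelve A6 @ 3 cells admit such a witness (seat script `scripts/gen_p3_witness_lean.py`, table
`scripts/p3_witnesses.json`; no Rohrlich corner at 3 in the window) — so at `p = 3`, exactly as at `p ≥ 5`, what an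
A6 cell carries on the BSTW road is the PRE status of the engine (here incl. (3-ii)♭), not an (α)-corner flag.

References: [BurungaleSkinnerTianWan2024] Thm 1.3, Rem 5.1, §3.2.3, II §2.3 (PRE); [Kobayashi2003] Conjecture (p. 2);
[BhargavaVarma2016] Cor. 4 (a); [Ribet1990] Thm 1.1; [Diamond1995RefinedSerre] Thm 1.1; [Wiles2015ClassGroups] Thm 0.0.1;
[Cox2013] Thm 2.13 / 7.7(ii); [Cremona2006] Table 1; cell records REPORT-bstw-7, bstw-MEMO-7, TARGET.md v12 §1.1.
-/

set_option autoImplicit false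
set_option linter.dupNamespace false

noncomputable section

open scoped Classical

open WeierstrassCurve NumberField Literature.NumberTheory.EllipticCurves
  Literature.NumberTheory.EllipticCurves.ModularForms
  Literature.NumberTheory.EllipticCurves.Rank1Residual
  Literature.NumberTheory.EllipticCurves.Rank1Residual.Typed
  Literature.NumberTheory.EllipticCurves.Rank1Residual.X11RankOneCertificates
  Literature.NumberTheory.QuadraticFields
  Summit.BirchSwinnertonDyer.Rank1Residual.Supersingular
  Summit.BirchSwinnertonDyer.Rank1Residual.SecondDescent
  Summit.BirchSwinnertonDyer.Rank1Residual.X11b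
  Summit.BirchSwinnertonDyer.BirchSwinnertonDyer.Rank1Residual.IntModel

namespace Summit.BirchSwinnertonDyer.BirchSwinnertonDyer.Theorems

/-! ### The registered stub `stub_three` and the crux, from the tier binders -/

/-- **`stub_three` (verbatim header) MODULO the `p = 3` TIER binder AND class-wide scope witnesses at 3.**
IF the p = 3 tier of the cell's reading of BSTW Thm 1.3 holds (`hBSTW : BurungaleSkinnerTianWan2024_thm13_scopedAtThree_OPEN`,
UNREFEREED, resting on (3-ii)♭) AND every X6 pair at `p = 3` admits a (ram) prime / auxiliary imaginary quadratic field
with `3 ∤ h_L` (`hwit3` — NOT free class-wide; decidable per class, discharged below for the window's twelve cells), then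
`∃ ε, KobayashiLowerDivisibility W 3 ε` on X6 at `3`. CONDITIONAL; closes nothing.
[claim: BurungaleSkinnerTianWan2024, status: under-review] [cite: Kobayashi2003, Conjecture (Main Conjecture) (p. 2)] -/
theorem stub_three_of_thm13_scopedAtThree_OPEN (hBSTW : BurungaleSkinnerTianWan2024_thm13_scopedAtThree_OPEN)
    (hwit3 : ∀ (W : WeierstrassCurve ℚ) [W.IsElliptic] [W.IsGloballyMinimal],
      ClassX6 W 3 → BSTWScope.HasWitness W 3) :
    ∀ (W : WeierstrassCurve ℚ) [W.IsElliptic] [W.IsGloballyMinimal],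
      Literature.NumberTheory.EllipticCurves.Rank1Residual.ClassX6 W 3 →
      ∃ ε : ℤˣ, Summit.BirchSwinnertonDyer.Rank1Residual.Supersingular.KobayashiLowerDivisibility W 3 ε := by
  intro W _ _ hX
  exact ⟨1, X6.kobayashiLowerDivisibility_of_thm13_scopedAtThree_OPEN W 3 hBSTW rfl hX (hwit3 W hX) 1⟩

/-- **The crux BY NAME from the two TIER binders and the class-wide witnesses.** What `KobayashiLowerHalfSemistable`
reduces to on the cell's readings of record: (i) the `p ≥ 5` tier (cell-verified, PRE source; REPORT-bstw-6), (ii) the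
`p = 3` tier (PRE resting on (3-ii)♭; REPORT-bstw-7), (iii) ONE class-wide L-witness hypothesis at every odd `p` (open
in print class-wide — Wiles 2015 Thm 0.0.1 / Beckwith–Raum–Richter 2023 Thm 1 / Bruinier 1999 each miss one of the
S2 conditions —, decidable per class). CONDITIONAL (`conditional-result`); the item stays OPEN.
[claim: BurungaleSkinnerTianWan2024, status: under-review] [cite: Kobayashi2003, Conjecture (Main Conjecture) (p. 2)] -/
theorem KobayashiLowerHalfSemistable_of_thm13_scoped_OPEN_of_scopedAtThree_OPEN
    (hBSTW5 : BurungaleSkinnerTianWan2024_thm13_scoped_OPEN)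
    (hBSTW3 : BurungaleSkinnerTianWan2024_thm13_scopedAtThree_OPEN)
    (hwit : ∀ (W : WeierstrassCurve ℚ) [W.IsElliptic] [W.IsGloballyMinimal] (p : ℕ) [Fact p.Prime],
      p ≠ 2 → ClassX6 W p → BSTWScope.HasWitness W p) :
    Summit.BirchSwinnertonDyer.BirchSwinnertonDyer.Theses.SignedLowerHalves.KobayashiLowerHalfSemistable := by
  intro W _ _ p _ hp hX
  exact ⟨1, kobayashiLowerDivisibility_of_mainConjecture
    (X6.kobayashiMainConjecture_of_thm13_scoped_OPEN_of_scopedAtThree_OPEN hBSTW5 hBSTW3 W p hp hX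
      (hwit W p hp hX) 1)⟩

/-! ### At `p = 3` the scope witness is FREE class-wide (Ribet–Diamond + Bhargava–Varma) -/

/-- **The S1/S2/(α) witness at `p = 3` for EVERY semistable curve with good supersingular reduction at `3`,
from PUBLISHED facts by name.** S1: `E[3]` is irreducible (supersingular at `3`,
`hasIrreducibleModPGaloisRep_of_dvd_frobeniusTrace`), so by Ribet–Diamond level-lowering (tree theorem
`ram_of_semistable_of_irr_of_le_seven`, modulo modularity `hmod` and `hLL` = Diamond 1995 Thm 1.1) some
multiplicative prime `q` has `3 ∤ ord_q(Δ_min)`. S2 + G3 + (α): apply the Bhargava–Varma fact `hBV` with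
`S = ({3, 2} ∪ {ℓ ∣ Δ_min}) ∖ {q}` (split) and `T = {q}` (inert): the field `L` it returns is imaginary
quadratic, has `3` split, `q` inert and unramified, every other bad prime split and unramified, `2` split (or
`2 = q` inert — then `2` is a bad prime and G3 is vacuous), hence `(d_L, 2N) = 1`, and `3 ∤ h_L`. So
`BSTWScope.HasWitness W 3`. UNCONDITIONAL modulo the three published named facts; class-wide; closes nothing.
[cite: BhargavaVarma2016, Cor. 4 (a) (p. 237)] [cite: Ribet1990, Thm. 1.1] [cite: Diamond1995RefinedSerre, Thm. 1.1] -/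
theorem BSTWScope_hasWitness_three_of_semistable (hmod : exists_isNewformOf)
    (hLL : Literature.NumberTheory.Automorphic.diamond1995_refinedSerre)
    (hBV : bhargavaVarma2016_exists_imaginaryQuadratic_split_inert_three_not_dvd_classNumber)
    (W : WeierstrassCurve ℚ) [W.IsElliptic] [W.IsGloballyMinimal]
    (hsst : Semistable W) (hss : GoodSS W 3) : BSTWScope.HasWitness W 3 := by
  -- S1: a (ram) prime `q` from Ribet–Diamond level-lowering (`E[3]` irreducible: supersingular at 3)
  have hirr : Irr W 3 :=
    hasIrreducibleModPGaloisRep_of_dvd_frobeniusTrace W 3 (by decide)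
      (W.not_dvd_minimalDiscriminantInt_of_hasGoodReductionAtPrime' 3 hss.1) hss.2
  obtain ⟨q, hqF, hq3, hmult, hord⟩ :=
    ram_of_semistable_of_irr_of_le_seven hmod hLL W 3 (by decide) (by decide) hsst hirr
  have hqP : q.Prime := hqF.out
  -- S2 + G3 + (α): Bhargava–Varma with S = ({3, 2} ∪ bad primes) \ {q} split, T = {q} inert
  set B : Finset ℕ := (minimalDiscriminantInt W).natAbs.primeFactors with hB
  set S : Finset ℕ := (insert 3 (insert 2 B)).erase q with hS
  have hSprime : ∀ p ∈ S, p.Prime := by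
    intro p hp
    rcases Finset.mem_insert.mp (Finset.mem_of_mem_erase hp) with rfl | hp'
    · norm_num
    rcases Finset.mem_insert.mp hp' with rfl | hp''
    · norm_num
    exact Nat.prime_of_mem_primeFactors hp''
  have hdisj : Disjoint S {q} := by
    rw [Finset.disjoint_singleton_right]
    exact Finset.notMem_erase q _
  obtain ⟨L, _instF, _instN, h2, hneg, hSsplit, hTinert, hh⟩ :=
    hBV S {q} hSprime (by simpa using hqP) hdisj
  have hqT : q ∈ ({q} : Finset ℕ) := Finset.mem_singleton_self q
  have hbadB : ∀ ℓ : ℕ, (hℓ : ℓ.Prime) →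
      (haveI : Fact ℓ.Prime := ⟨hℓ⟩; ¬ W.HasGoodReductionAtPrime ℓ) → ℓ ∈ B := by
    intro ℓ hℓ hbad
    haveI : Fact ℓ.Prime := ⟨hℓ⟩
    have hd := natCast_dvd_minimalDiscriminantInt_of_not_hasGoodReductionAtPrime (W := W) ℓ hbad
    rw [hB, Nat.mem_primeFactors]
    refine ⟨hℓ, ?_, Int.natAbs_ne_zero.mpr (minimalDiscriminantInt_ne_zero W)⟩
    have := Int.natAbs_dvd_natAbs.mpr hd
    simpa using this
  have hmemS : ∀ ℓ : ℕ, ℓ ≠ q → (ℓ = 3 ∨ ℓ = 2 ∨ ℓ ∈ B) → ℓ ∈ S := by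
    intro ℓ hℓq h
    rw [hS, Finset.mem_erase]
    refine ⟨hℓq, ?_⟩
    rcases h with rfl | rfl | h
    · exact Finset.mem_insert_self _ _
    · exact Finset.mem_insert_of_mem (Finset.mem_insert_self _ _)
    · exact Finset.mem_insert_of_mem (Finset.mem_insert_of_mem h)
  refine ⟨q, hqF, L, _instF, _instN, ⟨hq3, hmult, hord⟩, ⟨?_, ?_, ?_, ?_, ?_, ?_, ?_⟩, hh⟩
  · exact (isImaginaryQuadratic_iff_discr_neg).mpr ⟨h2, hneg⟩
  · exact (hSsplit 3 (hmemS 3 (Ne.symm hq3) (Or.inl rfl))).2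
  · exact (hTinert q hqT).2
  · intro ℓ hℓ hℓq hbad
    exact (hSsplit ℓ (hmemS ℓ hℓq (Or.inr (Or.inr (hbadB ℓ hℓ hbad))))).2
  · by_cases h2q : (2 : ℕ) = q
    · have := (hTinert q hqT).1
      rw [← h2q] at this
      exact_mod_cast this
    · exact_mod_cast (hSsplit 2 (hmemS 2 h2q (Or.inr (Or.inl rfl)))).1
  · intro ℓ hℓ hbad
    by_cases hℓq : ℓ = q
    · subst hℓq; exact (hTinert ℓ hqT).1
    · exact (hSsplit ℓ (hmemS ℓ hℓq (Or.inr (Or.inr (hbadB ℓ hℓ hbad))))).1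
  · intro hgood2
    by_cases h2q : (2 : ℕ) = q
    · subst h2q
      exact absurd hgood2 (not_hasGoodReductionAtPrime_of_hasMultiplicativeReductionAtPrime 2 hmult)
    · exact_mod_cast (hSsplit 2 (hmemS 2 h2q (Or.inr (Or.inl rfl)))).2

/-- **`stub_three` (verbatim header) MODULO the `p = 3` TIER binder and THREE PUBLISHED named facts — NO per-class
hypothesis.** The class-wide witness `hwit3` of `stub_three_of_thm13_scopedAtThree_OPEN` is DISCHARGED by
`BSTWScope_hasWitness_three_of_semistable` (modularity `hmod`, Diamond/Ribet level-lowering `hLL`, Bhargava–Varma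
`hBV`; all published, consumed by name). So the `p = 3` half of crux 2 costs EXACTLY the p = 3 tier binder
(PRE, resting on (3-ii)♭) beyond print. CONDITIONAL (`conditional-result` on the binder); closes nothing.
[claim: BurungaleSkinnerTianWan2024, status: under-review] [cite: BhargavaVarma2016, Cor. 4 (a) (p. 237)]
[cite: Ribet1990, Thm. 1.1] [cite: Diamond1995RefinedSerre, Thm. 1.1] [cite: Kobayashi2003, Conjecture (Main Conjecture) (p. 2)] -/
theorem stub_three_of_thm13_scopedAtThree_OPEN_of_published
    (hBSTW : BurungaleSkinnerTianWan2024_thm13_scopedAtThree_OPEN) (hmod : exists_isNewformOf)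
    (hLL : Literature.NumberTheory.Automorphic.diamond1995_refinedSerre)
    (hBV : bhargavaVarma2016_exists_imaginaryQuadratic_split_inert_three_not_dvd_classNumber) :
    ∀ (W : WeierstrassCurve ℚ) [W.IsElliptic] [W.IsGloballyMinimal],
      Literature.NumberTheory.EllipticCurves.Rank1Residual.ClassX6 W 3 →
      ∃ ε : ℤˣ, Summit.BirchSwinnertonDyer.Rank1Residual.Supersingular.KobayashiLowerDivisibility W 3 ε :=
  stub_three_of_thm13_scopedAtThree_OPEN hBSTW fun W _ _ hX =>
    BSTWScope_hasWitness_three_of_semistable hmod hLL hBV W hX.2.1 hX.1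

/-- **The crux BY NAME from the two TIER binders, THREE PUBLISHED facts, and the class-wide witness AT `p ≥ 5`
ONLY.** Compared with `KobayashiLowerHalfSemistable_of_thm13_scoped_OPEN_of_scopedAtThree_OPEN`, the witness
hypothesis is now restricted to `5 ≤ p` (where it is open in print: Wiles 2015 / Beckwith–Raum–Richter 2023 /
Bruinier 1999 each miss one S2 condition); at `p = 3` it is discharged from print. CONDITIONAL
(`conditional-result`); the item stays OPEN. [claim: BurungaleSkinnerTianWan2024, status: under-review]
[cite: BhargavaVarma2016, Cor. 4 (a) (p. 237)] [cite: Kobayashi2003, Conjecture (Main Conjecture) (p. 2)] -/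
theorem KobayashiLowerHalfSemistable_of_tiers_of_published
    (hBSTW5 : BurungaleSkinnerTianWan2024_thm13_scoped_OPEN)
    (hBSTW3 : BurungaleSkinnerTianWan2024_thm13_scopedAtThree_OPEN) (hmod : exists_isNewformOf)
    (hLL : Literature.NumberTheory.Automorphic.diamond1995_refinedSerre)
    (hBV : bhargavaVarma2016_exists_imaginaryQuadratic_split_inert_three_not_dvd_classNumber)
    (hwit5 : ∀ (W : WeierstrassCurve ℚ) [W.IsElliptic] [W.IsGloballyMinimal] (p : ℕ) [Fact p.Prime],
      5 ≤ p → ClassX6 W p → BSTWScope.HasWitness W p) :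
    Summit.BirchSwinnertonDyer.BirchSwinnertonDyer.Theses.SignedLowerHalves.KobayashiLowerHalfSemistable := by
  refine KobayashiLowerHalfSemistable_of_thm13_scoped_OPEN_of_scopedAtThree_OPEN hBSTW5 hBSTW3 ?_
  intro W _ _ p _ hp hX
  by_cases h5 : 5 ≤ p
  · exact hwit5 W p h5 hX
  · have hpP : p.Prime := Fact.out
    have h2 := hpP.two_le
    have hp3 : p = 3 := by
      interval_cases p
      · exact absurd rfl hp
      · rfl
      · exact absurd hpP (by decide)
    subst hp3
    exact BSTWScope_hasWitness_three_of_semistable hmod hLL hBV W hX.2.1 hX.1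

/-! ### `2534e1 @ 3` -/

/-- `#Ẽ(𝔽₃) = 4` for `2534e1` (`a₃ = 0`: good SUPERSINGULAR at `3`, and the X6 clause at `p = 3`; kernel count). [folklore] -/
theorem card_c2534e1_3 :
    Nat.card (((⟨1, -1, 1, -1393324, -640018129⟩ : WeierstrassCurve ℤ).map
      (Int.castRingHom (ZMod 3))).toAffine.Point) = 4 :=
  natCard_point_eq_of_countPoints 1 (-1) 1 (-1393324) (-640018129) 3 (by norm_num) (by decide +kernel)
    (by decide +kernel)

/-- `ClassX6 W 3` for `2534e1` read off the integer model (`3 ∤ Δ`, `#Ẽ(𝔽₃) = 4`, `gcd(Δ, c₄) = 1`) by cc-eng-4's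
`classX6_three_of_intModel`. [cite: Cremona2006, Table 1 (Cremona label 2534e1)] [cite: SilvermanAEC2009, VII.5 Prop. 5.1(a) and (b)] -/
theorem classX6_c2534e1_3 {W : WeierstrassCurve ℚ} [W.IsElliptic] [W.IsGloballyMinimal]
    (hWeq : W = ⟨1, -1, 1, -1393324, -640018129⟩) : ClassX6 W 3 := by
  have hIW : integralModelInt W = ⟨1, -1, 1, -1393324, -640018129⟩ :=
    integralModelInt_eq_of_map_eq _ (by rw [hWeq]; ext <;> simp [WeierstrassCurve.map])
  exact classX6_three_of_intModel hIW (by decide +kernel) card_c2534e1_3 (by decide +kernel)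

/-- **L-witness for `2534e1` at `p = 3`: `q = 181`, `L = ℚ(√−47)` (`h = 5`).** `2534e1 = [1, -1, 1, -1393324, -640018129]` (Cremona's minimal model),
`N = 2·7·181`, `Δ_min = −2^44·7·181^2`; the (ram) prime at `3` is `q = 181` (`ord_181 Δ = 2`, `3 ∤ 2`); `−47` is a prime
fundamental discriminant `≡ 1 (mod 8)` with `(−47/ℓ) = +1` for `ℓ ∈ {3, 2, 7}` (split: `3` and the primes of `N/181`),
`(−47/181) = −1` (inert), `(47, 6N) = 1`, and `h(−47) = 5`, `3 ∤ 5` (form class number by `decide`). Hence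
`BSTWScope.HasWitness W 3`. Unconditional; per pair; closes nothing.
[cite: Cremona2006, Table 1 (Cremona label 2534e1)] [cite: Cox2013, Thm. 2.13 (h(−47) = 5 by reduced forms)] -/
theorem BSTWScope_hasWitness_c2534e1_3 {W : WeierstrassCurve ℚ} [W.IsElliptic] [W.IsGloballyMinimal]
    (hWeq : W = ⟨1, -1, 1, -1393324, -640018129⟩) : BSTWScope.HasWitness W 3 := by
  haveI h181 : Fact (Nat.Prime 181) := ⟨by norm_num⟩
  have hIW : integralModelInt W = ⟨1, -1, 1, -1393324, -640018129⟩ :=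
    integralModelInt_eq_of_map_eq _ (by rw [hWeq]; ext <;> simp [WeierstrassCurve.map])
  set Lp : List ℕ := [2, 7, 181] with hLp
  have hLprime : ∀ q ∈ Lp, q.Prime := by
    simp only [hLp, List.mem_cons, List.mem_nil_iff, or_false]
    rintro q (rfl | rfl | rfl) <;> norm_num
  have hΔE : ∀ q : ℕ, q.Prime → (q : ℤ) ∣ (⟨1, -1, 1, -1393324, -640018129⟩ : WeierstrassCurve ℤ).Δ → q ∈ Lp :=
    forall_mem_of_natAbs_eq_prod_pow Lp [44, 1, 2] hLprime (by decide +kernel)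
  have hbadmem : ∀ ℓ : ℕ, (hℓ : ℓ.Prime) →
      (haveI : Fact ℓ.Prime := ⟨hℓ⟩; ¬ W.HasGoodReductionAtPrime ℓ) → ℓ ∈ Lp := by
    intro ℓ hℓ hbad
    haveI : Fact ℓ.Prime := ⟨hℓ⟩
    have hd := natCast_dvd_minimalDiscriminantInt_of_not_hasGoodReductionAtPrime (W := W) ℓ hbad
    rw [minimalDiscriminantInt_eq hIW] at hd
    exact hΔE ℓ hℓ hd
  have haux : BSTWScope.IsAuxiliaryPrime W 3 181 := by
    refine ⟨by decide, hasMultiplicativeReductionAtPrime_of_intModel hIW 181 (by decide +kernel)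
      (by decide +kernel), ?_⟩
    rw [minimalDiscriminantInt_eq hIW,
      padicValInt_eq_of_dvd_of_not_dvd 181 (e := 2) (by decide +kernel) (by decide +kernel)]
    decide
  refine BSTWScope.hasWitness_of_kronecker W 3 (by decide) 181 haux 47 ⟨by norm_num, ?_, by norm_num⟩
    (by norm_num) (by norm_num) ?_ ?_ (fun _ => by norm_num) ?_
  · exact Int.squarefree_natAbs.mp (by simpa using (by norm_num : Nat.Prime 47).squarefree)
  · intro ℓ hℓ hbad
    have hmem := hbadmem ℓ hℓ hbad
    simp only [hLp, List.mem_cons, List.mem_nil_iff, or_false] at hmem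
    rcases hmem with rfl | rfl | rfl <;> decide
  · intro ℓ hℓ hℓq hbad
    have hmem := hbadmem ℓ hℓ hbad
    simp only [hLp, List.mem_cons, List.mem_nil_iff, or_false] at hmem
    rcases hmem with rfl | rfl | rfl
    · exact ⟨fun _ => by norm_num, fun h => absurd rfl h⟩
    · exact ⟨fun h => absurd h (by decide), fun _ => by norm_num⟩
    · exact absurd rfl hℓq
  · have h5 : Literature.NumberTheory.QuadraticFields.BinaryQuadraticForm.classNumber (-(47 : ℕ) : ℤ) = 5 := by
      decide +kernel
    rw [h5]; decide

/-- **The Eisenstein half of Kobayashi's main conjecture for `2534e1` at `p = 3`, BOTH signs, MODULO ONLY the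
p = 3 tier binder** (`hBSTW : BurungaleSkinnerTianWan2024_thm13_scopedAtThree_OPEN`, PRE resting on (3-ii)♭): the
scope witness is the kernel theorem `BSTWScope_hasWitness_c2534e1_3`, the class is `classX6_c2534e1_3`. One of the 12 A6
cells of the window at `p = 3` (TARGET §1.1). CONDITIONAL on the PRE binder only; per pair; closes nothing; NOT bookable
on cell verification (RELAY-6). [claim: BurungaleSkinnerTianWan2024, status: under-review]
[cite: Cremona2006, Table 1 (Cremona label 2534e1)] -/
theorem kobayashiLowerDivisibility_c2534e1_3_of_thm13_scopedAtThree_OPEN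
    (hBSTW : BurungaleSkinnerTianWan2024_thm13_scopedAtThree_OPEN)
    {W : WeierstrassCurve ℚ} [W.IsElliptic] [W.IsGloballyMinimal]
    (hWeq : W = ⟨1, -1, 1, -1393324, -640018129⟩) (ε : ℤˣ) :
    Summit.BirchSwinnertonDyer.Rank1Residual.Supersingular.KobayashiLowerDivisibility W 3 ε :=
  X6.kobayashiLowerDivisibility_of_thm13_scopedAtThree_OPEN W 3 hBSTW rfl (classX6_c2534e1_3 hWeq)
    (BSTWScope_hasWitness_c2534e1_3 hWeq) ε

end Summit.BirchSwinnertonDyer.BirchSwinnertonDyer.Theorems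

end
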